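import Literature.GroupTheory.CombinatorialGroupTheory.FibredTranslationCocycles
import Literature.GroupTheory.CombinatorialGroupTheory.PuncturedSurfaceGroupCusps
import Mathlib.GroupTheory.QuotientGroup.Basic
import Mathlib.Algebra.Group.Subgroup.Pointwise
import Mathlib.GroupTheory.GroupAction.ConjAct
import Mathlib.GroupTheory.Index
import Mathlib.Tactic.Ring
import HarnessLib

/-!
# The cusp twist: level homomorphisms of `Γ_{g,r}` that see ONE level cusp over `c_0` and kill the plain letters

Topic `Literature/GroupTheory/CombinatorialGroupTheory`; PROOF-ONLY (0 definitions).  Mochizuki, [CombGC], PROOF of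
Prop. 1.2, p. 9, the resp'd (EDGE) case [cite: MochizukiCombGC2007, Prop 1.2 proof p.9] ("by gluing together
appropriate finite étale coverings of the anabelioids `G_v`, `G_e` …"), DISCRETE half at a CUSP `c_0` of a
one-vertex carrier whose vertex may have few cusps (the one-cusp irreducible nodal curve: `c_0 = (∏_i [a_i,b_i])⁻¹`
up to the loop, so no character separates the level cusps over `c_0` from each other or from the loop node).
Companions: `PuncturedSurfaceGroupNodeTwist.lean` (separating node), `PuncturedSurfaceGroupLoopTwist.lean` (loop).

THE TWIST (`exists_levelHom_cuspTwist`, `g ≥ 1`, `r ≥ 1`).  `N ⊴ Γ` of finite index, `Q = Γ/N`, `M` with a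
Heisenberg triple `X Y X⁻¹ Y⁻¹ = Z` (`Z` central, `Z^m = 1 ↔ q ∣ m`, `q > [Γ:N]³`).  `Γ` acts on `Q × M`: `c_0` by the fibred translation with cocycle `W·δ_{π(f₁)⁻¹}`
(`W = Z^{ord b̄_{g−1}}`), the LAST handle `g − 1` by one orbit cocycle carrying `W⁻¹` at the matching point, ALL
OTHER LETTERS PLAINLY; the relator acts trivially; `ψ : N → M` = the action of `N` on the fibre over `1`.  Besides
seeing the level cusp of `f₁` and killing every other level cusp over `c_0`, `ψ` KILLS every level conjugate of the
subgroup generated by the plain letters `a_i, b_i (i < g − 1)`, `c_j (j ≠ 0)` — in particular the loop node `⟨b_0⟩`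
when `g ≥ 2`.  `exists_normal_separating_cuspTwist` packages `Ker ψ` for abc-iut-w5-d047's
`IsProSigmaCompletion.exists_open_unrSeparating_of_discrete`.  abc-iut-f-060 (gen 9), row «NODE-RESIDUAL@UNMARKED»
of abc-iut-L3-lead γ85 (census stratum (4), `g ≥ 2`); nothing here bears on [IUTchIII] Cor. 3.12.
-/

namespace Literature.GroupTheory.CombinatorialGroupTheory

/-! ### The cusp twist -/

namespace PuncturedSurfaceGroup

open NodeTwist
open scoped Pointwise

variable {g r : ℕ}

/-- **The cusp twist** ([CombGC] Prop. 1.2 proof p. 9, discrete form at the cusp `c_0`, `g ≥ 1`, `r ≥ 1`).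
`N ⊴ Γ_{g,r}` of finite index, `f₁ ∈ Γ_{g,r}`, `M` a group with a Heisenberg triple `X Y X⁻¹ Y⁻¹ = Z`, `Z` central,
`Z^m = 1 ↔ q ∣ m`, `q > [Γ:N]³`.  Then some `ψ : N → M`
SEES the level cusp of `f₁` (`ψ(f₁ c_0^{[Γ:N]} f₁⁻¹) ≠ 1`), KILLS every other level cusp over `c_0`
(`ψ(z) = 1` for `z ∈ f₂⟨c_0⟩f₂⁻¹ ∩ N`, `f₁⁻¹ f₂ ∉ ⟨c_0⟩·N`), and KILLS `f y f⁻¹ ∈ N` for every `y` in the subgroup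
generated by the plain letters `a_i, b_i (i < g − 1)`, `c_j (j ≠ 0)`. [cite: MochizukiCombGC2007, Prop 1.2 proof p.9] -/
theorem exists_levelHom_cuspTwist (hg : 1 ≤ g) (hr : 1 ≤ r)
    (N : Subgroup (PuncturedSurfaceGroup g r)) [hN : N.Normal] [N.FiniteIndex]
    {M : Type*} [Group M] {X Y Z : M} (hXYZ : X * Y * X⁻¹ * Y⁻¹ = Z) (hZ : Z ∈ Subgroup.center M)
    {q : ℕ} (hZq : ∀ m : ℕ, Z ^ m = 1 ↔ q ∣ m) (hq : N.index ^ 3 < q)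
    (f₁ : PuncturedSurfaceGroup g r) :
    ∃ ψ : N →* M,
      ψ ⟨f₁ * c ⟨0, hr⟩ ^ N.index * f₁⁻¹, hN.conj_mem _ (Subgroup.pow_index_mem N _) f₁⟩ ≠ 1 ∧
      (∀ f₂ : PuncturedSurfaceGroup g r,
        f₁⁻¹ * f₂ ∉ (Subgroup.zpowers (c (g := g) (⟨0, hr⟩ : Fin r)) : Set (PuncturedSurfaceGroup g r)) *
            (N : Set (PuncturedSurfaceGroup g r)) →
        ∀ (z : PuncturedSurfaceGroup g r)
          (hz : z ∈ (ConjAct.toConjAct f₂ • Subgroup.zpowers (c (g := g) (⟨0, hr⟩ : Fin r))) ⊓ N),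
          ψ ⟨z, hz.2⟩ = 1) ∧
      ∀ (f y : PuncturedSurfaceGroup g r),
        y ∈ Subgroup.closure {s : PuncturedSurfaceGroup g r |
          (∃ i : Fin g, (i : ℕ) < g - 1 ∧ (s = a i ∨ s = b i)) ∨ ∃ j : Fin r, (j : ℕ) ≠ 0 ∧ s = c j} →
        ∀ hfy : f * y * f⁻¹ ∈ N, ψ ⟨f * y * f⁻¹, hfy⟩ = 1 := by
  classical
  -- indices and words
  set iL : Fin g := ⟨g - 1, by omega⟩ with hiL
  set j₀ : Fin r := ⟨0, hr⟩ with hj₀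
  set x : PuncturedSurfaceGroup g r := c j₀ with hxdef
  obtain ⟨w, hw⟩ : ∃ w : Fin g → PuncturedSurfaceGroup g r, ∀ i, w i = a i * b i * (a i)⁻¹ * (b i)⁻¹ :=
    ⟨_, fun _ => rfl⟩
  have hwfun : (fun i : Fin g => a (r := r) i * b i * (a i)⁻¹ * (b i)⁻¹) = w := funext fun i => (hw i).symm
  have hwc : ((List.finRange g).map w).prod * ((List.finRange r).map fun j : Fin r => c (g := g) j).prod = 1 := by
    rw [← hwfun]; exact comm_prod_mul_cusp_prod_eq_one
  obtain ⟨front, hfront⟩ : ∃ front : PuncturedSurfaceGroup g r, front = ((List.finRange g).map fun i : Fin g =>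
      if (i : ℕ) < g - 1 then w i else 1).prod := ⟨_, rfl⟩
  obtain ⟨ctail, hctail⟩ : ∃ ctail : PuncturedSurfaceGroup g r, ctail = ((List.finRange r).map fun j : Fin r =>
      if 1 ≤ (j : ℕ) then (if (j : ℕ) < r then c (g := g) j else 1) else 1).prod := ⟨_, rfl⟩
  have hw_split : ((List.finRange g).map w).prod = front * w iL := by
    rw [prod_map_finRange_split g (g - 1) w, hfront, ← prod_map_finRange_ite_eq iL w]
    congr 1
    refine congrArg List.prod (List.map_congr_left fun i _ => ?_)
    by_cases hi : i = iL
    · subst hi; rw [if_pos (by rw [hiL]), if_pos rfl]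
    · have hi' : ¬ g - 1 ≤ (i : ℕ) := fun h => hi (Fin.ext (by rw [hiL]; have := i.isLt; simp only; omega))
      rw [if_neg hi', if_neg hi]
  have hc_split : ((List.finRange r).map fun j : Fin r => c (g := g) j).prod = c j₀ * ctail := by
    have h0 : ((List.finRange r).map fun j : Fin r => c (g := g) j).prod =
        ((List.finRange r).map fun j : Fin r => if (j : ℕ) < r then c (g := g) j else 1).prod :=
      congrArg List.prod (List.map_congr_left fun j _ => by rw [if_pos j.isLt])
    rw [h0, hctail]
    exact prod_map_finRange_lt_eq_first_mul hr hr _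
  have hrelΓ : front * w iL * (c j₀ * ctail) = 1 := by rw [← hw_split, ← hc_split]; exact hwc
  -- the quotient
  set Q := PuncturedSurfaceGroup g r ⧸ N
  set π : PuncturedSurfaceGroup g r →* Q := QuotientGroup.mk' N with hπ
  have hπN : ∀ {y : PuncturedSurfaceGroup g r}, π y = 1 ↔ y ∈ N := fun {y} => by
    rw [hπ, QuotientGroup.mk'_apply, QuotientGroup.eq_one_iff]
  haveI : Finite Q := Subgroup.finite_quotient_of_finiteIndex
  have hcardQ : Nat.card Q = N.index := rfl
  set m := N.index with hm
  have hmpos : 0 < m := Nat.pos_of_ne_zero Subgroup.FiniteIndex.index_ne_zero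
  -- the active letters and the orbit length of the cancelling handle
  set vc := π (c j₀) with hvc
  set uL := π (a iL) with huL
  set vL := π (b iL) with hvL
  have hπwL : π (w iL) = uL * vL * uL⁻¹ * vL⁻¹ := by rw [hw, map_mul, map_mul, map_mul, map_inv, map_inv]
  set L := orderOf vL with hL
  have hL_le : L ≤ m := hcardQ ▸ orderOf_le_card
  have hL_pos : 0 < L := (isOfFinOrder_of_finite vL).orderOf_pos
  -- the charge `W = Z^L`, realised as `W⁻¹ = [Y, X^L]` by the cancelling handle
  set W := Z ^ L with hW
  have hchA : Y ^ 1 * X ^ L * (Y ^ 1)⁻¹ * (X ^ L)⁻¹ = W⁻¹ := by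
    rw [pow_comm_pow_eq_of_comm_eq_central hXYZ hZ 1 L, one_mul]
  -- the support points
  set p₁ : Q := π f₁⁻¹ with hp₁
  set cL : Q := vc * p₁ with hcL
  -- the orbit cocycle on the letter `a_{g−1}`
  obtain ⟨αA, hαA⟩ := exists_orbitCocycle vL (vL * uL⁻¹ * vL⁻¹ * cL) X (Y ^ 1)
  -- the fibred translations
  obtain ⟨σc₀, hσc₀⟩ := exists_twistPerm (M := M) vc (fun p => if p = p₁ then W else 1)
  obtain ⟨σaL, hσaL⟩ := exists_twistPerm (M := M) uL αA
  obtain ⟨σbL, hσbL⟩ := exists_twistPerm (M := M) vL (fun _ => X)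
  -- the plain translation
  obtain ⟨pl, hpl⟩ := exists_plainPerm (M := M) π
  have hpl' : ∀ y p m₀, pl y (p, m₀) = (π y * p, (1 : M) * m₀) := fun y p m₀ => by rw [hpl, one_mul]
  -- the commutator block of the cancelling handle
  have hBlB : ∀ p m₀, (σaL * σbL * σaL⁻¹ * σbL⁻¹) (p, m₀) =
      (uL * vL * uL⁻¹ * vL⁻¹ * p, (if p = cL then W⁻¹ else 1) * m₀) := by
    intro p m₀
    rw [twist_comm_apply hσaL hσbL, hαA, hchA]
    have eA : vL⁻¹ * (vL * uL⁻¹ * vL⁻¹ * cL) = uL⁻¹ * (vL⁻¹ * cL) := by group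
    rw [eA]
    simp only [mul_left_cancel_iff]
  -- the generator assignment
  let σ : puncturedSurfaceGen g r → Equiv.Perm (Q × M) := fun s =>
    match s with
    | Sum.inl (i, false) => if i = iL then σaL else pl (a i)
    | Sum.inl (i, true) => if i = iL then σbL else pl (b i)
    | Sum.inr j => if j = j₀ then σc₀ else pl (c j)
  have hσaL' : σ (Sum.inl (iL, false)) = σaL := by simp [σ]
  have hσbL' : σ (Sum.inl (iL, true)) = σbL := by simp [σ]
  have hσc₀' : σ (Sum.inr j₀) = σc₀ := by simp [σ]
  have hσa : ∀ i, i ≠ iL → σ (Sum.inl (i, false)) = pl (a i) := fun i h2 => by simp [σ, h2]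
  have hσb : ∀ i, i ≠ iL → σ (Sum.inl (i, true)) = pl (b i) := fun i h2 => by simp [σ, h2]
  have hσc : ∀ j, j ≠ j₀ → σ (Sum.inr j) = pl (c j) := fun j h2 => by simp [σ, h2]
  -- the blocks
  obtain ⟨Bl, hBl⟩ : ∃ Bl : Fin g → Equiv.Perm (Q × M), ∀ i, Bl i =
      σ (Sum.inl (i, false)) * σ (Sum.inl (i, true)) * (σ (Sum.inl (i, false)))⁻¹ *
        (σ (Sum.inl (i, true)))⁻¹ := ⟨_, fun _ => rfl⟩
  have hBl_plain : ∀ i, i ≠ iL → Bl i = pl (w i) := by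
    intro i h2
    rw [hBl, hw, hσa i h2, hσb i h2, map_mul, map_mul, map_mul, map_inv, map_inv]
  have hBlL : ∀ p m₀, Bl iL (p, m₀) = (π (w iL) * p, (if p = cL then W⁻¹ else 1) * m₀) := by
    intro p m₀
    rw [hBl, hσaL', hσbL', hBlB, hπwL]
  -- the product of all blocks: plain front, then the cancelling block
  have hBl_prod : ((List.finRange g).map Bl).prod = pl front * Bl iL := by
    rw [prod_map_finRange_split g (g - 1) Bl]
    congr 1
    · rw [hfront, map_list_prod, List.map_map]
      refine congrArg List.prod (List.map_congr_left fun i _ => ?_)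
      change _ = pl (if (i : ℕ) < g - 1 then w i else 1)
      by_cases h1 : (i : ℕ) < g - 1
      · rw [if_pos h1, if_pos h1]
        exact hBl_plain i fun h => by rw [h, hiL] at h1; simp at h1
      · rw [if_neg h1, if_neg h1, map_one]
    · rw [← prod_map_finRange_ite_eq iL Bl]
      refine congrArg List.prod (List.map_congr_left fun i _ => ?_)
      by_cases hi : i = iL
      · subst hi; rw [if_pos (by rw [hiL]), if_pos rfl]
      · have hi' : ¬ g - 1 ≤ (i : ℕ) := fun h => hi (Fin.ext (by rw [hiL]; have := i.isLt; simp only; omega))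
        rw [if_neg hi', if_neg hi]
  -- the product of the cusp letters: the twisted `c_0`, then the plain tail
  have hc_prod : ((List.finRange r).map fun j => σ (Sum.inr j)).prod = σc₀ * pl ctail := by
    have h0 : ((List.finRange r).map fun j => σ (Sum.inr j)).prod =
        ((List.finRange r).map fun j : Fin r => if (j : ℕ) < r then σ (Sum.inr j) else 1).prod :=
      congrArg List.prod (List.map_congr_left fun j _ => by rw [if_pos j.isLt])
    rw [h0, prod_map_finRange_lt_eq_first_mul hr hr (fun j => σ (Sum.inr j)), ← hj₀, hσc₀', hctail,
      map_list_prod, List.map_map]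
    congr 1
    refine congrArg List.prod (List.map_congr_left fun j _ => ?_)
    change _ = pl (if 1 ≤ (j : ℕ) then (if (j : ℕ) < r then c j else 1) else 1)
    by_cases h1 : 1 ≤ (j : ℕ)
    · rw [if_pos h1, if_pos h1, if_pos j.isLt, if_pos j.isLt]
      exact hσc j fun h => by rw [h, hj₀] at h1; simp at h1
    · rw [if_neg h1, if_neg h1, map_one]
  -- the relator acts trivially
  have hrel : ∀ R ∈ ({relator g r} : Set (FreeGroup (puncturedSurfaceGen g r))),
      FreeGroup.lift σ R = 1 := by
    intro R hR
    rw [Set.mem_singleton_iff] at hR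
    rw [hR, lift_relator]
    have h1 : (fun i : Fin g => σ (Sum.inl (i, false)) * σ (Sum.inl (i, true)) *
        (σ (Sum.inl (i, false)))⁻¹ * (σ (Sum.inl (i, true)))⁻¹) = Bl := funext fun i => (hBl i).symm
    rw [h1, hBl_prod, hc_prod]
    have h2 : pl front * Bl iL * (σc₀ * pl ctail) = pl (front * w iL * (c j₀ * ctail)) := by
      refine Equiv.ext fun z => ?_
      obtain ⟨p, m₀⟩ := z
      simp only [Equiv.Perm.mul_apply]
      rw [hpl ctail, hσc₀, hBlL, hpl, hpl, map_mul, map_mul, map_mul, ← hvc]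
      refine Prod.ext (by simp only [mul_assoc]) ?_
      change (if vc * (π ctail * p) = cL then W⁻¹ else 1) * ((if π ctail * p = p₁ then W else 1) * m₀) = m₀
      have hiff : vc * (π ctail * p) = cL ↔ π ctail * p = p₁ := by rw [hcL, mul_left_cancel_iff]
      by_cases hp : π ctail * p = p₁
      · rw [if_pos (hiff.mpr hp), if_pos hp, ← mul_assoc, inv_mul_cancel, one_mul]
      · rw [if_neg (fun h => hp (hiff.mp h)), if_neg hp, one_mul, one_mul]
    rw [h2, hrelΓ, map_one]
  -- the action
  let ρ : PuncturedSurfaceGroup g r →* Equiv.Perm (Q × M) := PresentedGroup.toGroup hrel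
  have hρ_of : ∀ s, ρ (PresentedGroup.of s) = σ s := fun s => PresentedGroup.toGroup.of hrel
  -- every `ρ γ` is a fibred translation over `π γ`
  have hfib : ∀ γ : PuncturedSurfaceGroup g r, ∃ κ : Q → M, ∀ p m₀, ρ γ (p, m₀) = (π γ * p, κ p * m₀) := by
    refine fibred_of_generators ρ π fun s => ?_
    rw [hρ_of]
    rcases s with ⟨i, _ | _⟩ | j
    · by_cases h2 : i = iL
      · subst h2; exact ⟨αA, by rw [hσaL']; exact hσaL⟩
      · exact ⟨fun _ => 1, by rw [hσa i h2]; exact hpl' _⟩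
    · by_cases h2 : i = iL
      · subst h2; exact ⟨fun _ => X, by rw [hσbL']; exact hσbL⟩
      · exact ⟨fun _ => 1, by rw [hσb i h2]; exact hpl' _⟩
    · by_cases h2 : j = j₀
      · subst h2; exact ⟨_, by rw [hσc₀']; exact hσc₀⟩
      · exact ⟨fun _ => 1, by rw [hσc j h2]; exact hpl' _⟩
  -- the plain letters act plainly
  have hρ_plain : ∀ y ∈ Subgroup.closure {s : PuncturedSurfaceGroup g r |
        (∃ i : Fin g, (i : ℕ) < g - 1 ∧ (s = a i ∨ s = b i)) ∨ ∃ j : Fin r, (j : ℕ) ≠ 0 ∧ s = c j},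
      ρ y = pl y := by
    intro y hy
    refine (Subgroup.closure_le (K := ρ.eqLocus pl)).mpr ?_ hy
    rintro s (⟨i, hi, rfl | rfl⟩ | ⟨j, hj, rfl⟩)
    · have hi' : i ≠ iL := fun h => by rw [h, hiL] at hi; simp at hi
      change ρ (PresentedGroup.of _) = _
      rw [hρ_of, hσa i hi']
    · have hi' : i ≠ iL := fun h => by rw [h, hiL] at hi; simp at hi
      change ρ (PresentedGroup.of _) = _
      rw [hρ_of, hσb i hi']
    · have hj' : j ≠ j₀ := fun h => by rw [h, hj₀] at hj; simp at hj
      change ρ (PresentedGroup.of _) = _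
      rw [hρ_of, hσc j hj']
  -- `ρ x` is the `W`-twist of `c_0` supported at `p₁`
  have hρx : ∀ p m₀, ρ x (p, m₀) = (π x * p, (if p = p₁ then W else 1) * m₀) := by
    intro p m₀
    have h1 : ρ x = σc₀ := by rw [hxdef]; exact (hρ_of _).trans hσc₀'
    rw [h1, hσc₀]
  -- powers of `ρ x`: plain along `⟨π x⟩`-orbits missing `p₁`, charge `W^e` at `p₁`
  have hK1 := fun (p : Q) (hp : ∀ i : ℕ, π x ^ i * p ≠ p₁) => twist_pow_apply_of_forall_ne hρx p hp
  have hK2 := twist_pow_apply_self hρx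
  -- the character of the fibre over `1`
  obtain ⟨z₁, hz₁⟩ : ∃ z₁ : Q × M, z₁ = (1, 1) := ⟨_, rfl⟩
  have hρN : ∀ {n : PuncturedSurfaceGroup g r}, n ∈ N → (ρ n z₁).1 = 1 := fun {n} hn => by
    obtain ⟨κ, hκ⟩ := hfib n
    rw [hz₁, hκ, hπN.mpr hn, one_mul]
  have hρ_snd : ∀ (γ : PuncturedSurfaceGroup g r) (p : Q) (m₀ m' : M),
      ρ γ (p, m₀ * m') = ((ρ γ (p, m₀)).1, (ρ γ (p, m₀)).2 * m') := fun γ p m₀ m' => by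
    obtain ⟨κ, hκ⟩ := hfib γ
    rw [hκ, hκ, mul_assoc]
  let ψ : N →* M :=
    { toFun := fun n => (ρ (n : PuncturedSurfaceGroup g r) z₁).2
      map_one' := by
        change (ρ ((1 : N) : PuncturedSurfaceGroup g r) z₁).2 = 1
        rw [OneMemClass.coe_one, map_one, Equiv.Perm.one_apply, hz₁]
      map_mul' := fun n n' => by
        change (ρ ((n : PuncturedSurfaceGroup g r) * n') z₁).2 =
          (ρ (n : PuncturedSurfaceGroup g r) z₁).2 * (ρ (n' : PuncturedSurfaceGroup g r) z₁).2
        have h := hρ_snd (n : PuncturedSurfaceGroup g r) 1 1 (ρ (n' : PuncturedSurfaceGroup g r) z₁).2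
        rw [one_mul, ← hz₁] at h
        have hn' : ρ (n' : PuncturedSurfaceGroup g r) z₁ = (1, (ρ (n' : PuncturedSurfaceGroup g r) z₁).2) :=
          Prod.ext (hρN n'.2) rfl
        rw [map_mul ρ, Equiv.Perm.mul_apply, hn', h] }
  have hψ : ∀ (n : PuncturedSurfaceGroup g r) (hn : n ∈ N), ψ ⟨n, hn⟩ = (ρ n z₁).2 := fun _ _ => rfl
  -- evaluation on a level conjugate `f y f⁻¹` of an element `y` FIXING the fibre over `π f⁻¹` pointwise …
  have heval_fix : ∀ (f y : PuncturedSurfaceGroup g r) (hy : f * y * f⁻¹ ∈ N),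
      (∀ m₀, ρ y (π f⁻¹, m₀) = (π f⁻¹, m₀)) → ψ ⟨f * y * f⁻¹, hy⟩ = 1 := by
    intro f y hy hfix
    rw [hψ, map_mul ρ, map_mul ρ, Equiv.Perm.mul_apply, Equiv.Perm.mul_apply]
    obtain ⟨κ, hκ⟩ := hfib f⁻¹
    have h0 : ρ f⁻¹ z₁ = (π f⁻¹, κ 1) := by rw [hz₁, hκ, mul_one, mul_one]
    rw [h0, hfix, ← h0, ← Equiv.Perm.mul_apply, ← map_mul, mul_inv_cancel, map_one,
      Equiv.Perm.one_apply, hz₁]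
  -- … or MULTIPLYING the fibre over `π f⁻¹` by `W^e`
  have heval_pow : ∀ (f y : PuncturedSurfaceGroup g r) (hy : f * y * f⁻¹ ∈ N) (e : ℕ),
      (∀ m₀, ρ y (π f⁻¹, m₀) = (π f⁻¹, W ^ e * m₀)) →
        ∃ t : M, ψ ⟨f * y * f⁻¹, hy⟩ = t⁻¹ * W ^ e * t := by
    intro f y hy e hmul
    obtain ⟨κ, hκ⟩ := hfib f⁻¹
    obtain ⟨κ', hκ'⟩ := hfib f
    have h0 : ρ f⁻¹ z₁ = (π f⁻¹, κ 1) := by rw [hz₁, hκ, mul_one, mul_one]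
    have h1 : ρ f (π f⁻¹, κ 1) = z₁ := by
      rw [← h0, ← Equiv.Perm.mul_apply, ← map_mul, mul_inv_cancel, map_one, Equiv.Perm.one_apply]
    have h2 : κ' (π f⁻¹) * κ 1 = 1 := by
      have h := h1; rw [hκ', hz₁] at h; exact (Prod.mk.inj h).2
    refine ⟨κ 1, ?_⟩
    rw [hψ, map_mul ρ, map_mul ρ, Equiv.Perm.mul_apply, Equiv.Perm.mul_apply, h0, hmul, hκ',
      ← mul_assoc, eq_inv_of_mul_eq_one_left h2]
  refine ⟨ψ, ?_, ?_, ?_⟩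
  · -- ALIVE: the level node of `f₁`
    obtain ⟨e, he1, he2, he⟩ := hK2 m
    have hxm : π x ^ m * p₁ = p₁ := by
      rw [← map_pow, hπN.mpr (Subgroup.pow_index_mem N x), one_mul]
    have hmul : ∀ m₀, ρ (x ^ m) (π f₁⁻¹, m₀) = (π f₁⁻¹, W ^ e * m₀) := fun m₀ => by
      rw [map_pow, ← hp₁, he m₀, hxm]
    obtain ⟨t, ht⟩ := heval_pow f₁ (x ^ m) (hN.conj_mem _ (Subgroup.pow_index_mem N x) f₁) e hmul
    rw [ht]
    intro h0
    have hWe : W ^ e = 1 := by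
      rw [show W ^ e = t * (t⁻¹ * W ^ e * t) * t⁻¹ by group, h0]; group
    rw [hW, ← pow_mul, hZq] at hWe
    have hle : q ≤ L * e := Nat.le_of_dvd (Nat.mul_pos hL_pos (he1 hmpos)) hWe
    have hle' : L * e ≤ m ^ 3 := by
      calc L * e ≤ m * m := Nat.mul_le_mul hL_le he2
        _ ≤ m * m * m := Nat.le_mul_of_pos_right _ hmpos
        _ = m ^ 3 := by ring
    omega
  · -- KILL: every other level node
    intro f₂ hf₂ z hz
    obtain ⟨hz1, hz2⟩ := Subgroup.mem_inf.mp hz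
    obtain ⟨y, hy, hyz⟩ := (Subgroup.mem_smul_pointwise_iff_exists _ _ _).mp hz1
    have hz' : z = f₂ * y * f₂⁻¹ := by rw [← hyz, ConjAct.smul_def, ConjAct.ofConjAct_toConjAct]
    have hz2' : f₂ * y * f₂⁻¹ ∈ N := hz' ▸ hz2
    have hsub : (⟨z, hz.2⟩ : N) = ⟨f₂ * y * f₂⁻¹, hz2'⟩ := Subtype.ext hz'
    rw [hsub]
    -- the `⟨π x⟩`-orbit of `π f₂⁻¹` misses `p₁`
    have hmiss : ∀ i : ℕ, π x ^ i * π f₂⁻¹ ≠ p₁ := by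
      intro i hi
      apply hf₂
      rw [hp₁, ← map_pow, ← map_mul, hπ, QuotientGroup.mk'_apply, QuotientGroup.mk'_apply,
        QuotientGroup.eq] at hi
      refine Set.mem_mul.mpr ⟨x ^ i, Subgroup.npow_mem_zpowers x i,
        f₂⁻¹ * ((x ^ i * f₂⁻¹)⁻¹ * f₁⁻¹) * f₂, ?_, by group⟩
      have h := hN.conj_mem _ hi f₂⁻¹
      rwa [inv_inv] at h
    -- natural powers of `x` conjugated into `N` by `f₂` fix the fibre over `π f₂⁻¹` pointwise
    have hynat : ∀ n : ℕ, f₂ * x ^ n * f₂⁻¹ ∈ N → ∀ m₀, ρ (x ^ n) (π f₂⁻¹, m₀) = (π f₂⁻¹, m₀) := by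
      intro n hn m₀
      have hxn : x ^ n ∈ N := by
        have h := hN.conj_mem _ hn f₂⁻¹
        simpa only [inv_inv, mul_assoc, inv_mul_cancel_left, inv_mul_cancel, mul_one] using h
      have h1 : π x ^ n * π f₂⁻¹ = π f₂⁻¹ := by rw [← map_pow, hπN.mpr hxn, one_mul]
      rw [map_pow, hK1 (π f₂⁻¹) hmiss n m₀, h1]
    obtain ⟨k, rfl⟩ := Subgroup.mem_zpowers_iff.mp hy
    rcases Int.eq_nat_or_neg k with ⟨n, rfl | rfl⟩
    · have hn : f₂ * x ^ n * f₂⁻¹ ∈ N := by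
        have h := hz2'
        rwa [zpow_natCast] at h
      exact heval_fix f₂ _ hz2' fun m₀ => by rw [zpow_natCast]; exact hynat n hn m₀
    · have hn : f₂ * x ^ n * f₂⁻¹ ∈ N := by
        have h := N.inv_mem hz2'
        simpa only [mul_inv_rev, inv_inv, zpow_neg, zpow_natCast, mul_assoc] using h
      refine heval_fix f₂ _ hz2' fun m₀ => ?_
      rw [zpow_neg, zpow_natCast, map_inv, Equiv.Perm.inv_def, Equiv.symm_apply_eq]
      exact (hynat n hn m₀).symm


  · -- KILL: level conjugates of the plain letters
    intro f y hy hfy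
    have hyN : y ∈ N := by
      have h := hN.conj_mem _ hfy f⁻¹
      simpa only [inv_inv, mul_assoc, inv_mul_cancel_left, inv_mul_cancel, mul_one] using h
    refine heval_fix f y hfy fun m₀ => ?_
    rw [hρ_plain y hy, hpl, hπN.mpr hyN, one_mul]

end PuncturedSurfaceGroup

end Literature.GroupTheory.CombinatorialGroupTheory
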